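import Summits.ValiantsHypothesis.ValiantsHypothesis.Theorems.SymPencilPerFourOriginPackage

/-!
# Route `SymPencil` — the origin package of a symmetric representation of `per_4`, WITH the pencil
# identity at every base point of the kernel space (interface; `--supports`
# stmt-ValiantsHypothesis-5674; rung currency for `sdc(per_4)`, nothing here bears on `VP ≠ VNP`)

`SymPencilPerFourOriginPackage.origin_package_of_isSymm_isAffineDetRepr_perPoly_four` exports, from
a symmetric affine determinantal representation `A = A₀ + M(z)` of `per_4` of size `m`
(characteristic `0`), the data `(i₀, D, bL, CL, κ)` of the kernel normal form at the origin and the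
three origin moments.  This file re-runs that bookkeeping ONCE MORE (the exported data are bound to
the normal form, so a new reading cannot be bolted on from outside) and adds, for every `v` with
`bL v = 0` — i.e. `A(v) w₀ = 0`, the kernel vector SURVIVES at `v` — the normal form of the pencil
based at `v` (`SymPencilOriginNormalForm.det_origin_blocks` applied to `A(v) = A₀ + M(v)`, which
is symmetric, kills `w₀`, and has rank `≥ m - 1` by von zur Gathen–ABV regularity AT THE POINT `v`):

 * `D + CL v` is invertible, and
 * `κ · per_4 (v + s z) = det [[0, s bL(z)ᵀ], [s bL(z), D + CL v + s CL z]]` for all `s, z`.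

At `v = 0` this is the origin identity; at `v ≠ 0` in a ONE-ROW kernel the cubic term
`s³ per_4(v; z)` is alive, and `SymPencilBasePointMoments` / `SymPencilPerFourOneRowKernel` turn it
into the identities that kill the cells `(12,4,0)`, `(12,4,1)`.  Bookkeeping only. [folklore]
-/

noncomputable section

-- single-conjunct layout: Sub = Summit, duplicated namespace component intended
set_option linter.dupNamespace false

namespace Summit.ValiantsHypothesis.ValiantsHypothesis.Theorems.SymPencilPerFourBasePointPackage

open Matrix MvPolynomial Module
open Literature.Computability.AlgebraicComplexity
open Literature.Computability.AlgebraicComplexity.AlperBogartVelasco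
open Summit.ValiantsHypothesis.ValiantsHypothesis.Theorems.SymPencilHomogeneousHessianRank
open Summit.ValiantsHypothesis.ValiantsHypothesis.Theorems.SymPencilHomogeneousConeKernel
open Summit.ValiantsHypothesis.ValiantsHypothesis.Theorems.SymPencilHomogeneousDropRankCodim
open Summit.ValiantsHypothesis.ValiantsHypothesis.Theorems.SymPencilOriginMoments
open Summit.ValiantsHypothesis.ValiantsHypothesis.Theorems.SymPencilOriginNormalForm
open Summit.ValiantsHypothesis.ValiantsHypothesis.Theorems.SymPencilIsotropicKernelSquaresBilinear
open Summit.ValiantsHypothesis.ValiantsHypothesis.Theorems.SymPencilBoxFourEquality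

/-- **The origin package as data, with the base-point identities.**  See the module docstring.
[folklore] -/
theorem basepoint_package_of_isSymm_isAffineDetRepr_perPoly_four (K : Type*) [Field K]
    [CharZero K]
    {m : ℕ} {A : Matrix (Fin m) (Fin m) (MvPolynomial (Fin 4 × Fin 4) K)}
    (hS : A.IsSymm) (hA : IsAffineDetRepr (perPoly (Fin 4) K) A) :
    ∃ (i₀ : Fin m) (D : Matrix {i // i ≠ i₀} {i // i ≠ i₀} K)
      (bL : (Fin 4 × Fin 4 → K) →ₗ[K] ({i // i ≠ i₀} → K))
      (CL : (Fin 4 × Fin 4 → K) →ₗ[K] Matrix {i // i ≠ i₀} {i // i ≠ i₀} K) (κ : K),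
      IsUnit D.det ∧ Dᵀ = D ∧ (∀ z, (CL z)ᵀ = CL z) ∧ κ ≠ 0 ∧
      (∀ z, bL z ⬝ᵥ D⁻¹ *ᵥ bL z = 0) ∧
      (∀ z, bL z ⬝ᵥ (D⁻¹ * CL z * D⁻¹) *ᵥ bL z = 0) ∧
      (∀ z, D.det * (bL z ⬝ᵥ (D⁻¹ * CL z * D⁻¹ * CL z * D⁻¹) *ᵥ bL z) =
        -(κ * eval z (perPoly (Fin 4) K))) ∧
      (∀ x ∈ LinearMap.ker bL, ∀ r c : Fin 4,
        ((Matrix.of fun i j => x (i, j)).submatrix r.succAbove c.succAbove).permanent = 0) ∧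
      Fintype.card {i // i ≠ i₀} + 1 = m ∧
      2 * finrank K (LinearMap.range bL) ≤ Fintype.card {i // i ≠ i₀} ∧
      finrank K (LinearMap.range bL) + finrank K (LinearMap.ker bL) = 16 ∧
      finrank K (LinearMap.ker bL) ≤ 8 ∧
      (∀ v, bL v = 0 → IsUnit (D + CL v).det ∧ ∀ (z : Fin 4 × Fin 4 → K) (s : K),
        κ * eval (v + s • z) (perPoly (Fin 4) K) =
          (Matrix.fromBlocks ((s * 0) • (1 : Matrix Unit Unit K))
            (Matrix.replicateRow Unit (s • bL z)) (Matrix.replicateCol Unit (s • bL z))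
            (D + CL v + s • CL z)).det) := by
  classical
  obtain ⟨hdeg, hdet⟩ := hA
  have hhom : (perPoly (Fin 4) K).IsHomogeneous 4 := by
    simpa using (perPoly_isHomogeneous (n := Fin 4) (k := K))
  -- the pencil `A = A₀ + Σ_v X_v A_v`
  set A₀ : Matrix (Fin m) (Fin m) K := constPart A with hA₀
  let Mlin : (Fin 4 × Fin 4 → K) →ₗ[K] Matrix (Fin m) (Fin m) K :=
    { toFun := fun z => ∑ v, z v • LRPencil.coeffMat A v
      map_add' := fun z₁ z₂ => by
        simp only [Pi.add_apply, add_smul, Finset.sum_add_distrib]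
      map_smul' := fun c z => by
        simp only [Pi.smul_apply, smul_eq_mul, mul_smul, Finset.smul_sum, RingHom.id_apply] }
  have hMlin : ∀ z, Mlin z = ∑ v, z v • LRPencil.coeffMat A v := fun z => rfl
  have hAz : ∀ z, A.map (eval z) = A₀ + Mlin z := fun z => by
    rw [hMlin, hA₀]
    exact LRPencil.map_eval_eq A hdeg z
  have hdetz : ∀ z, (A₀ + Mlin z).det = eval z (perPoly (Fin 4) K) := fun z => by
    rw [← hAz, ← RingHom.mapMatrix_apply, ← RingHom.map_det, hdet]
  have hcoeffs : ∀ v, (LRPencil.coeffMat A v)ᵀ = LRPencil.coeffMat A v := fun v => by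
    ext i j; simp only [transpose_apply, LRPencil.coeffMat_apply, hS.apply i j]
  have hA₀s : A₀ᵀ = A₀ := by
    ext i j; simp only [hA₀, transpose_apply, constPart_apply, hS.apply i j]
  have hMs : ∀ z, (Mlin z)ᵀ = Mlin z := fun z => by
    rw [hMlin, Matrix.transpose_sum]
    exact Finset.sum_congr rfl fun v _ => by rw [Matrix.transpose_smul, hcoeffs]
  have hMsingle : ∀ v, Mlin (Pi.single v 1) = LRPencil.coeffMat A v := fun v => by
    rw [hMlin]
    rw [Finset.sum_eq_single v (fun u _ hu => by rw [Pi.single_eq_of_ne hu, zero_smul])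
      (fun h => absurd (Finset.mem_univ v) h), Pi.single_eq_same, one_smul]
  -- regularity everywhere (von zur Gathen) and the kernel vector of `A₀`
  have hreg : ∀ x : Fin 4 × Fin 4 → K, m ≤ (A₀ + Mlin x).rank + 1 := fun x => by
    have h := AlperBogartVelasco.le_rank_map_eval_add_one two_ne_zero (by norm_num) A hdet x
    rwa [hAz] at h
  have hA₀det : A₀.det = 0 := by
    have h := hdetz 0
    rw [map_zero, add_zero] at h
    rw [h]
    have h0 := eval_smul_of_isHomogeneous hhom (0 : K) (0 : Fin 4 × Fin 4 → K)
    rwa [zero_smul, zero_pow (by norm_num), zero_mul] at h0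
  obtain ⟨w, hw, hA₀w⟩ := Matrix.exists_mulVec_eq_zero_iff.mpr hA₀det
  have hrank0 : m ≤ A₀.rank + 1 := by simpa using hreg 0
  -- the reindexing through `i₀` with `w i₀ ≠ 0`
  obtain ⟨i₀, hi₀⟩ : ∃ i, w i ≠ 0 := Function.ne_iff.mp hw
  let e : Fin m ≃ Unit ⊕ {i // i ≠ i₀} :=
    { toFun := fun i => if h : i = i₀ then Sum.inl () else Sum.inr ⟨i, h⟩
      invFun := Sum.elim (fun _ => i₀) fun i => i.1
      left_inv := fun i => by
        by_cases h : i = i₀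
        · simp [h]
        · simp [h]
      right_inv := by
        rintro (u | ⟨i, hi⟩)
        · simp
        · simp [hi] }
  have he0 : e.symm (Sum.inl ()) = i₀ := rfl
  have hcard : Fintype.card {i // i ≠ i₀} + 1 = m := by
    have hc : Fintype.card (Fin m) = Fintype.card (Unit ⊕ {i // i ≠ i₀}) := Fintype.card_congr e
    rw [Fintype.card_sum, Fintype.card_unit, Fintype.card_fin] at hc
    omega
  set w' : Unit ⊕ {i // i ≠ i₀} → K := w ∘ e.symm with hw'
  have hre : ∀ N : Matrix (Fin m) (Fin m) K, Matrix.reindex e e N *ᵥ w' = (N *ᵥ w) ∘ e.symm := by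
    intro N
    rw [Matrix.reindex_apply, Matrix.submatrix_mulVec_equiv]
    have hwe : w' ∘ e.symm.symm = w := by
      ext i
      simp [hw']
    rw [hwe]
  have hdot : ∀ u : Fin m → K, w' ⬝ᵥ (u ∘ e.symm) = w ⬝ᵥ u := fun u => by
    rw [hw']
    exact Fintype.sum_equiv e.symm _ _ fun i => rfl
  set A₀' : Matrix (Unit ⊕ {i // i ≠ i₀}) (Unit ⊕ {i // i ≠ i₀}) K := Matrix.reindex e e A₀
    with hA₀'
  let Rm : Matrix (Fin m) (Fin m) K →ₗ[K]
      Matrix (Unit ⊕ {i // i ≠ i₀}) (Unit ⊕ {i // i ≠ i₀}) K :=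
    (Matrix.reindexLinearEquiv K K e e).toLinearMap
  have hRm : ∀ N, Rm N = Matrix.reindex e e N := fun N => rfl
  set M' := Rm ∘ₗ Mlin with hM'
  have hM'z : ∀ z, M' z = Matrix.reindex e e (Mlin z) := fun z => rfl
  have hA₀'s : A₀'ᵀ = A₀' := by rw [hA₀', Matrix.transpose_reindex, hA₀s]
  have hM's : ∀ z, (M' z)ᵀ = M' z := fun z => by rw [hM'z, Matrix.transpose_reindex, hMs]
  have hw'0 : w' (Sum.inl ()) ≠ 0 := by rw [hw', Function.comp_apply, he0]; exact hi₀
  have hA₀'w : A₀' *ᵥ w' = 0 := by rw [hA₀', hre, hA₀w]; rfl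
  have hrank' : Fintype.card {i // i ≠ i₀} ≤ A₀'.rank := by
    rw [hA₀', Matrix.rank_reindex]; omega
  -- the origin normal form and homogeneity
  obtain ⟨hD, hDs, hCs, hblocks⟩ := det_origin_blocks A₀' hA₀'s w' hw'0 hA₀'w hrank' M' hM's
  set D := A₀'.toBlocks₂₂ with hDdef
  have hdet' : ∀ (s : K) (z : Fin 4 × Fin 4 → K),
      (A₀' + s • M' z).det = s ^ 4 * eval z (perPoly (Fin 4) K) := by
    intro s z
    have h1 : A₀' + s • M' z = Matrix.reindex e e (A₀ + Mlin (s • z)) := by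
      rw [hA₀', hM'z, map_smul]
      rfl
    rw [h1, Matrix.reindex_apply, Matrix.det_submatrix_equiv_self, hdetz,
      eval_smul_of_isHomogeneous hhom]
  -- the kernel-row and block families as linear maps
  let bL : (Fin 4 × Fin 4 → K) →ₗ[K] ({i // i ≠ i₀} → K) :=
    { toFun := fun z i => (M' z *ᵥ w') (Sum.inr i)
      map_add' := fun z₁ z₂ => by
        ext i; simp only [map_add, Matrix.add_mulVec, Pi.add_apply]
      map_smul' := fun c z => by
        ext i; simp only [map_smul, Matrix.smul_mulVec, Pi.smul_apply, RingHom.id_apply] }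
  have hbL : ∀ z, bL z = fun i => (M' z *ᵥ w') (Sum.inr i) := fun z => rfl
  let CL : (Fin 4 × Fin 4 → K) →ₗ[K] Matrix {i // i ≠ i₀} {i // i ≠ i₀} K :=
    { toFun := fun z => (M' z).toBlocks₂₂
      map_add' := fun z₁ z₂ => by
        ext i j; simp only [map_add, Matrix.toBlocks₂₂, Matrix.add_apply, Matrix.of_apply]
      map_smul' := fun c z => by
        ext i j
        simp only [map_smul, Matrix.toBlocks₂₂, Matrix.smul_apply, Matrix.of_apply,
          RingHom.id_apply] }
  have hCL : ∀ z, CL z = (M' z).toBlocks₂₂ := fun z => rfl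
  -- the origin moments, for every `z`
  have hmom : ∀ z : Fin 4 × Fin 4 → K, w' ⬝ᵥ M' z *ᵥ w' = 0 ∧ bL z ⬝ᵥ D⁻¹ *ᵥ bL z = 0 ∧
      bL z ⬝ᵥ (D⁻¹ * CL z * D⁻¹) *ᵥ bL z = 0 ∧
      D.det * (bL z ⬝ᵥ (D⁻¹ * CL z * D⁻¹ * CL z * D⁻¹) *ᵥ bL z) =
        -(w' (Sum.inl ()) ^ 2 * eval z (perPoly (Fin 4) K)) := by
    intro z
    refine moments_four hD (w' ⬝ᵥ M' z *ᵥ w') (w' (Sum.inl ()) ^ 2) (eval z (perPoly (Fin 4) K))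
      (bL z) fun s => ?_
    rw [hbL, hCL, hDdef, ← hblocks s z, hdet']
    ring
  have ha : ∀ z, w' ⬝ᵥ M' z *ᵥ w' = 0 := fun z => (hmom z).1
  -- `ker bL`: the kernel rows vanish entirely, so `A(v) w = 0`
  have hMw : ∀ v, bL v = 0 → Mlin v *ᵥ w = 0 := by
    intro v hv
    have h1 : M' v *ᵥ w' = 0 := by
      have hinr : ∀ i, (M' v *ᵥ w') (Sum.inr i) = 0 := fun i => by
        have := congr_fun hv i
        rwa [hbL] at this
      have hinl : (M' v *ᵥ w') (Sum.inl ()) = 0 := by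
        have h := ha v
        rw [dotProduct, Fintype.sum_sum_type] at h
        simp only [Finset.univ_unique, Finset.sum_singleton, hinr, mul_zero,
          Finset.sum_const_zero, add_zero, PUnit.default_eq_unit] at h
        exact (mul_eq_zero.1 h).resolve_left hw'0
      ext (u | i)
      · exact hinl
      · exact hinr i
    rw [hM'z, hre] at h1
    ext j
    have := congr_fun h1 (e j)
    simpa using this
  -- all first partials of `per_4` vanish on `ker bL`
  have hpart : ∀ v, bL v = 0 → ∀ u : Fin 4 × Fin 4,
      eval v (pderiv u (perPoly (Fin 4) K)) = 0 := by
    intro v hv u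
    set Y : Matrix (Fin m) (Fin m) K := A₀ + Mlin v with hYdef
    have hYs : Yᵀ = Y := by rw [hYdef, Matrix.transpose_add, hA₀s, hMs]
    have hYw : Y *ᵥ w = 0 := by rw [hYdef, Matrix.add_mulVec, hA₀w, hMw v hv, add_zero]
    obtain ⟨c₀, hc₀⟩ := adjugate_eq_smul_vecMulVec hYs hw hYw (by
      have h := hreg v; rw [Fintype.card_fin]; exact h)
    rw [← hdet, DeterminantalConormal.eval_pderiv_det, hAz, ← hYdef, hc₀]
    have hcoe : A.map (fun p => eval v (pderiv u p)) = LRPencil.coeffMat A u := by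
      ext i j
      simp only [Matrix.map_apply, LRPencil.coeffMat_apply,
        AlperBogartVelasco.pderiv_eq_C_coeff (hdeg i j), eval_C]
    rw [hcoe, Matrix.smul_mul, Matrix.trace_smul, Matrix.vecMulVec_mul, Matrix.trace_vecMulVec,
      smul_eq_mul, ← Matrix.mulVec_transpose, hcoeffs, ← hMsingle, ← hdot, ← hre, ← hM'z,
      ha, mul_zero]
  -- `ker bL ⊆ Sing Z(per_4)` in both forms, and its dimension `≤ 8` (BoxFour)
  have hV4 : ∀ x ∈ LinearMap.ker bL, ∀ r c : Fin 4,
      ((Matrix.of fun i j => x (i, j)).submatrix r.succAbove c.succAbove).permanent = 0 := by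
    intro x hx r c
    rw [← eval_pderiv_perPoly_eq_permanent_submatrix]
    exact hpart x (LinearMap.mem_ker.1 hx) (r, c)
  have hkerle : finrank K (LinearMap.ker bL) ≤ 8 :=
    finrank_le_eight_of_subperm_three_vanish (LinearMap.ker bL) hV4
  -- dimension of the image: `2 r ≤ m - 1` (isotropy)
  have hDis : (D⁻¹)ᵀ = D⁻¹ := by rw [Matrix.transpose_nonsing_inv, hDs]
  have hDiu : IsUnit D⁻¹ :=
    (Matrix.isUnit_iff_isUnit_det _).2 (Matrix.isUnit_nonsing_inv_det_iff.2 hD)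
  have hranle : 2 * finrank K (LinearMap.range bL) ≤ Fintype.card {i // i ≠ i₀} := by
    have h := rank_add_two_mul_finrank_le_of_quadratic_form_eq_zero hDis (LinearMap.range bL)
      (by rintro _ ⟨z, rfl⟩; exact (hmom z).2.1)
    rw [Matrix.rank_of_isUnit _ hDiu] at h
    omega
  have hrn := LinearMap.finrank_range_add_finrank_ker bL
  rw [Module.finrank_fintype_fun_eq_card, Fintype.card_prod, Fintype.card_fin] at hrn
  have hκ : w' (Sum.inl ()) ^ 2 ≠ 0 := pow_ne_zero 2 hw'0
  -- the base-point identities: the same normal form at every `v ∈ ker bL`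
  have hM'w : ∀ v, bL v = 0 → M' v *ᵥ w' = 0 := by
    intro v hv
    have hinr : ∀ i, (M' v *ᵥ w') (Sum.inr i) = 0 := fun i => by
      have := congr_fun hv i
      rwa [hbL] at this
    have hinl : (M' v *ᵥ w') (Sum.inl ()) = 0 := by
      have h := ha v
      rw [dotProduct, Fintype.sum_sum_type] at h
      simp only [Finset.univ_unique, Finset.sum_singleton, hinr, mul_zero,
        Finset.sum_const_zero, add_zero, PUnit.default_eq_unit] at h
      exact (mul_eq_zero.1 h).resolve_left hw'0
    ext (u | i)
    · exact hinl
    · exact hinr i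
  have hre2 : ∀ v z (s : K),
      A₀' + M' v + s • M' z = Matrix.reindex e e (A₀ + Mlin (v + s • z)) := by
    intro v z s
    rw [hA₀', hM'z, hM'z, map_add Mlin, map_smul Mlin]
    simp only [Matrix.reindex_apply, Matrix.submatrix_add, Matrix.submatrix_smul, add_assoc,
      Pi.add_apply, Pi.smul_apply]
  have hbase : ∀ v, bL v = 0 → IsUnit (D + CL v).det ∧ ∀ (z : Fin 4 × Fin 4 → K) (s : K),
      w' (Sum.inl ()) ^ 2 * eval (v + s • z) (perPoly (Fin 4) K) =
        (Matrix.fromBlocks ((s * 0) • (1 : Matrix Unit Unit K))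
          (Matrix.replicateRow Unit (s • bL z)) (Matrix.replicateCol Unit (s • bL z))
          (D + CL v + s • CL z)).det := by
    intro v hv
    have hA₀vs : (A₀' + M' v)ᵀ = A₀' + M' v := by rw [Matrix.transpose_add, hA₀'s, hM's]
    have hA₀vw : (A₀' + M' v) *ᵥ w' = 0 := by rw [Matrix.add_mulVec, hA₀'w, hM'w v hv, add_zero]
    have hrankv : Fintype.card {i // i ≠ i₀} ≤ (A₀' + M' v).rank := by
      have h1 := hre2 v 0 0
      rw [zero_smul, add_zero, smul_zero, add_zero] at h1
      rw [h1, Matrix.rank_reindex]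
      have h2 := hreg v
      omega
    obtain ⟨hDv, -, -, hblocksv⟩ :=
      det_origin_blocks (A₀' + M' v) hA₀vs w' hw'0 hA₀vw hrankv M' hM's
    have htb : (A₀' + M' v).toBlocks₂₂ = D + CL v := by
      ext i j
      simp only [hDdef, hCL, Matrix.toBlocks₂₂, Matrix.add_apply, Matrix.of_apply]
    rw [htb] at hDv hblocksv
    refine ⟨hDv, fun z s => ?_⟩
    have h2 := hblocksv s z
    rw [ha z, hre2 v z s, Matrix.reindex_apply, Matrix.det_submatrix_equiv_self, hdetz] at h2
    rw [h2, hbL z, hCL z]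
  exact ⟨i₀, D, bL, CL, w' (Sum.inl ()) ^ 2, hD, hDs, hCs, hκ, fun z => (hmom z).2.1,
    fun z => (hmom z).2.2.1, fun z => (hmom z).2.2.2, hV4, hcard, hranle, hrn, hkerle, hbase⟩


end Summit.ValiantsHypothesis.ValiantsHypothesis.Theorems.SymPencilPerFourBasePointPackage

end
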